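import Literature.AnabelianGeometry.SemiGraphs.TemperedCoverings
import Literature.AnabelianGeometry.SemiGraphs.SemiGraphCuspOmission
import Literature.AnabelianGeometry.SemiGraphs.SemiGraphLocal

/-!
# Restricting `B^cov(𝒢)` / `B^temp(𝒢)` to a sub-semi-graph; extension along a cusp omission ([SemiAnbd] §3 p. 36; [IUTchI] §2 p. 44) — DEFINITIONS

Mochizuki, *Semi-graphs of anabelioids*, Publ. RIMS **42** (2006), §3 pp. 36–37 (the categories
`B^cov(𝒢) ⊇ B^temp(𝒢)` of systems `{S_v, S_e, S_e ≅ b^* S_v}` of countable discrete continuous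
`Π_v`- and `Π_e`-sets) and Def. 2.1 p. 24 (the restriction `𝒢_ℍ` to a sub-semi-graph)
[cite: MochizukiSemiAnbd2006, §3 p.36]; Mochizuki, *Inter-universal Teichmüller theory I*, §2 p. 44
l. 28–30: "the omission of cuspidal edges clearly does not affect either the tempered or pro-`Σ̂`
fundamental groups" [cite: Mochizuki2012, §2 p.44].

In the tree's TEMPERED presentation (`ProfiniteSemiGraph`, `CovObj`, `BTempCat`, `TemperedPiChart`
of `TemperedCoverings.lean`, abc-iut-L3-t2) there was no restriction to a sub-semi-graph
(`TemperedCoveringsRestrict.lean` restricts an object to a union of its connected components, a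
different operation).  This DEFINITIONS file (abc-iut row W4-30 part 2, the tempered half of the
[IUTchI] p. 44 merge atom) supplies:

* `ProfiniteSemiGraph.restrict 𝒢 H` — the semi-graph of profinite groups `𝒢_ℍ` (same vertex /
  edge groups and branch homomorphisms over the sub-semi-graph `ℍ`);
* `ProfiniteSemiGraph.covRestrict H : CovObj 𝒢 ⥤ CovObj (𝒢.restrict H)` — restriction of
  coverings, with `covRestrict ⋙ restrictV = restrictV`, `covRestrict ⋙ restrictE = restrictE`
  definitionally, and the point map `CovObj.pointOfRestrict`;
* for a CUSP OMISSION `ℍ` (`SemiGraph.Subgraph.IsCuspOmission`, tree): the extension of morphisms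
  (`CovObj.homOfRestrict`) and of objects (`CovObj.extendSE`, `CovObj.extendAlongCusps`,
  `CovObj.extendAlongCuspsIso`) along the omitted cusps — over a cusp `e ⊸ v` with verticial branch
  `b` the new fibre is `S_e := b^* S_v` glued by the identity ("an open edge carries only the
  pulled-back `Π_v`-set").

The theorems (equivalence `B^cov(𝒢) ≌ B^cov(𝒢_ℍ)`, transport of temperedness, `B^temp(𝒢) ≌
B^temp(𝒢_ℍ)`, `Π^tp` unchanged) are the proof-only companions `TemperedCuspOmission*.lean`.
Definitions + definitional laws only; nothing here takes a side on [IUTchIII] Cor. 3.12.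
-/

namespace Literature.AnabelianGeometry.SemiGraphs

namespace ProfiniteSemiGraph

open CategoryTheory

universe u

variable (𝒢 : ProfiniteSemiGraph.{u})

/-! ### Restriction to a sub-semi-graph -/

/-- `𝒢_ℍ`: the semi-graph of profinite groups obtained by restricting `𝒢` to a sub-semi-graph
`ℍ ⊆ 𝔾` — underlying semi-graph `ℍ`, the same groups `Π_v`, `Π_e` and branch homomorphisms `b_*`
([SemiAnbd] Def. 2.1 p. 24 "`(𝒢_ℍ)_c := 𝒢_c`", in the presentation of §3 p. 36).
[cite: MochizukiSemiAnbd2006, Def. 2.1 p.24] -/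
noncomputable def restrict (H : 𝒢.graph.Subgraph) : ProfiniteSemiGraph.{u} where
  graph := H.toSemiGraph
  Gv v := 𝒢.Gv v.1
  Ge e := 𝒢.Ge e.1
  brHom b v h := 𝒢.brHom b.1 v.1 ((H.abuts_eq_some_iff b v).mp h)

/-- The vertex groups of `𝒢_ℍ` are those of `𝒢` (definitional). [cite: MochizukiSemiAnbd2006, Def. 2.1 p.24] -/
theorem restrict_Gv (H : 𝒢.graph.Subgraph) (v : H.toSemiGraph.Vertex) :
    (𝒢.restrict H).Gv v = 𝒢.Gv v.1 := rfl

/-- The edge groups of `𝒢_ℍ` are those of `𝒢` (definitional). [cite: MochizukiSemiAnbd2006, Def. 2.1 p.24] -/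
theorem restrict_Ge (H : 𝒢.graph.Subgraph) (e : H.toSemiGraph.Edge) :
    (𝒢.restrict H).Ge e = 𝒢.Ge e.1 := rfl

/-- **Restriction of coverings** `B^cov(𝒢) ⥤ B^cov(𝒢_ℍ)`: keep the fibres and gluings over the
components of `ℍ` ("the restriction of `𝒢' → 𝒢` to …", [SemiAnbd] Def. 3.5 (ii) p. 37, here to a
sub-semi-graph). [cite: MochizukiSemiAnbd2006, Def 3.5(ii) p.37] -/
noncomputable def covRestrict (H : 𝒢.graph.Subgraph) : CovObj 𝒢 ⥤ CovObj (𝒢.restrict H) where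
  obj S := { SV := fun v => S.SV v.1, SE := fun e => S.SE e.1, glue := fun b v h => S.glue b.1 v.1 _ }
  map f := { fV := fun v => f.fV v.1, fE := fun e => f.fE e.1, comm := fun b v h => f.comm b.1 v.1 _ }

/-- `covRestrict ⋙ (S ↦ S_v) = (S ↦ S_v)` (definitional). [cite: MochizukiSemiAnbd2006, Def 3.5(ii) p.37] -/
theorem covRestrict_comp_restrictV (H : 𝒢.graph.Subgraph) (v : H.toSemiGraph.Vertex) :
    𝒢.covRestrict H ⋙ restrictV (𝒢.restrict H) v = restrictV 𝒢 v.1 := rfl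

/-- `covRestrict ⋙ (S ↦ S_e) = (S ↦ S_e)` (definitional). [cite: MochizukiSemiAnbd2006, Def 3.5(ii) p.37] -/
theorem covRestrict_comp_restrictE (H : 𝒢.graph.Subgraph) (e : H.toSemiGraph.Edge) :
    𝒢.covRestrict H ⋙ restrictE (𝒢.restrict H) e = restrictE 𝒢 e.1 := rfl

variable {𝒢}

/-- A point of the restricted covering `S|_ℍ` is a point of `S` (over a component of `ℍ`).
[cite: MochizukiSemiAnbd2006, Def 3.5(ii) p.37] -/
def CovObj.pointOfRestrict {H : 𝒢.graph.Subgraph} (S : CovObj 𝒢) :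
    ((𝒢.covRestrict H).obj S).Point → S.Point
  | Sum.inl ⟨v, x⟩ => Sum.inl ⟨v.1, x⟩
  | Sum.inr ⟨e, x⟩ => Sum.inr ⟨e.1, x⟩

/-- `pointOfRestrict` is injective. [cite: MochizukiSemiAnbd2006, Def 3.5(ii) p.37] -/
theorem CovObj.pointOfRestrict_injective {H : 𝒢.graph.Subgraph} (S : CovObj 𝒢) :
    Function.Injective (S.pointOfRestrict (H := H)) := by
  rintro (⟨⟨v, hv⟩, x⟩ | ⟨⟨e, he⟩, x⟩) (⟨⟨v', hv'⟩, x'⟩ | ⟨⟨e', he'⟩, x'⟩) h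
  · obtain ⟨hvv, hx⟩ := Sigma.mk.inj_iff.mp (Sum.inl.inj h)
    dsimp only at hvv
    subst hvv
    obtain rfl := heq_iff_eq.mp hx
    rfl
  · cases h
  · cases h
  · obtain ⟨hee, hx⟩ := Sigma.mk.inj_iff.mp (Sum.inr.inj h)
    dsimp only at hee
    subst hee
    obtain rfl := heq_iff_eq.mp hx
    rfl

/-! ### Extension along a cusp omission -/

/-- A *verticial branch* of the edge `e` of a semi-graph: a branch `b ∈ e` together with the vertex
it abuts to (an element of the verticial portion `ζ_e⁻¹(𝒱)`, [SemiAnbd] §1 p. 11, with its image).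
[cite: MochizukiSemiAnbd2006, §1 p.11] -/
structure _root_.Literature.AnabelianGeometry.SemiGraphs.SemiGraph.VerticialBranch
    (G : SemiGraph.{u}) (e : G.Edge) : Type u where
  /-- the branch -/
  branch : G.Branch
  /-- the vertex it abuts to -/
  vertex : G.Vertex
  /-- it is a branch of `e` -/
  edgeOf_branch : G.edgeOf branch = e
  /-- it abuts to `vertex` -/
  abuts_branch : G.abuts branch = some vertex

/-- The chosen verticial branch of an omitted edge of a cusp omission (abc-iut-L3-t1 g2's `cusp`
data, packaged). [cite: MochizukiSemiAnbd2006, §1 p.13] -/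
noncomputable def _root_.Literature.AnabelianGeometry.SemiGraphs.SemiGraph.Subgraph.IsCuspOmission.cuspBranch
    {G : SemiGraph.{u}} {H : G.Subgraph} (hH : H.IsCuspOmission) (e : G.Edge) (he : e ∉ H.edges) :
    G.VerticialBranch e :=
  ⟨(hH.cusp e he).1, (hH.cusp e he).2, hH.edgeOf_cusp e he, hH.abuts_cusp e he⟩


/-- Transport of an object of `B^temp(Π_{e₁})` to `B^temp(Π_{e₂})` along an equality of edges
`e₁ = e₂` (bookkeeping: `b^*` lands over `edgeOf b`); the identity when `e₁ ≡ e₂`.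
[cite: MochizukiSemiAnbd2006, §3 p.36] -/
def castSE {e₁ e₂ : 𝒢.graph.Edge} (h : e₁ = e₂) (X : BTemp (𝒢.Ge e₁)) : BTemp (𝒢.Ge e₂) := h ▸ X

/-- Transport along a reflexive equality is the identity. [cite: MochizukiSemiAnbd2006, §3 p.36] -/
@[simp] theorem castSE_rfl {e : 𝒢.graph.Edge} (X : BTemp (𝒢.Ge e)) : castSE rfl X = X := rfl

/-- The edge fibre over a cusp `e` determined by a family of vertex fibres through a verticial branch
`b ∈ e` abutting to `v`: the pull-back `b^* S_v` (transported to `Π_e`).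
[cite: MochizukiSemiAnbd2006, §3 p.36] -/
def cuspSE (SV : ∀ v : 𝒢.graph.Vertex, BTemp (𝒢.Gv v)) {e : 𝒢.graph.Edge}
    (c : 𝒢.graph.VerticialBranch e) : BTemp (𝒢.Ge e) :=
  castSE c.edgeOf_branch ((BTemp.res (𝒢.brHom c.branch c.vertex c.abuts_branch)).obj (SV c.vertex))

/-- For the verticial branch `(b, v)` itself, `cuspSE` is literally `b^* S_v`.
[cite: MochizukiSemiAnbd2006, §3 p.36] -/
theorem res_obj_eq_cuspSE (SV : ∀ v : 𝒢.graph.Vertex, BTemp (𝒢.Gv v)) {b : 𝒢.graph.Branch}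
    {v : 𝒢.graph.Vertex} (h : 𝒢.graph.abuts b = some v)
    (c : 𝒢.graph.VerticialBranch (𝒢.graph.edgeOf b)) (hbc : b = c.branch) :
    (BTemp.res (𝒢.brHom b v h)).obj (SV v) = cuspSE SV c := by
  obtain ⟨b₀, v₀, hb₀, hv₀⟩ := c
  dsimp only at hbc
  subst hbc
  obtain rfl : v = v₀ := Option.some_injective _ (h.symm.trans hv₀)
  rfl

namespace CovObj

variable {H : 𝒢.graph.Subgraph}

/-- Transport of a morphism of edge fibres `S_{e₁} → T_{e₁}` to `S_{e₂} → T_{e₂}` along `e₁ = e₂`.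
[cite: MochizukiSemiAnbd2006, §3 p.36] -/
def castSEHom (S T : CovObj 𝒢) {e₁ e₂ : 𝒢.graph.Edge} (h : e₁ = e₂) (f : S.SE e₁ ⟶ T.SE e₁) :
    S.SE e₂ ⟶ T.SE e₂ := by
  subst h
  exact f

/-- Transport along a reflexive equality is the identity. [cite: MochizukiSemiAnbd2006, §3 p.36] -/
@[simp] theorem castSEHom_rfl (S T : CovObj 𝒢) {e : 𝒢.graph.Edge} (f : S.SE e ⟶ T.SE e) :
    castSEHom S T rfl f = f := rfl

/-- Over a verticial branch `(b, v)` of `e`: the morphism of edge fibres `S_e → T_e` forced by a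
morphism of vertex fibres `φ : S_v → T_v` through the gluings, `glue_T⁻¹ ∘ b^*(φ) ∘ glue_S`
(transported from `edgeOf b` to `e`). [cite: MochizukiSemiAnbd2006, §3 p.36] -/
def cuspHom (S T : CovObj 𝒢) {e : 𝒢.graph.Edge} (c : 𝒢.graph.VerticialBranch e)
    (φ : S.SV c.vertex ⟶ T.SV c.vertex) : S.SE e ⟶ T.SE e :=
  castSEHom S T c.edgeOf_branch
    ((S.glue c.branch c.vertex c.abuts_branch).hom ≫
      (BTemp.res (𝒢.brHom c.branch c.vertex c.abuts_branch)).map φ ≫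
        (T.glue c.branch c.vertex c.abuts_branch).inv)

/-- `cuspHom` is compatible with the gluings at the verticial branch.
[cite: MochizukiSemiAnbd2006, §3 p.36] -/
theorem cuspHom_comm (S T : CovObj 𝒢) (φ : ∀ v, S.SV v ⟶ T.SV v) {b : 𝒢.graph.Branch}
    {v : 𝒢.graph.Vertex} (h : 𝒢.graph.abuts b = some v)
    (c : 𝒢.graph.VerticialBranch (𝒢.graph.edgeOf b)) (hbc : b = c.branch) :
    cuspHom S T c (φ c.vertex) ≫ (T.glue b v h).hom =
      (S.glue b v h).hom ≫ (BTemp.res (𝒢.brHom b v h)).map (φ v) := by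
  obtain ⟨b₀, v₀, hb₀, hv₀⟩ := c
  dsimp only at hbc
  subst hbc
  obtain rfl : v = v₀ := Option.some_injective _ (h.symm.trans hv₀)
  change castSEHom S T rfl _ ≫ _ = _
  simp

open Classical in
/-- **Extension of a morphism along a cusp omission**: for a cusp omission `ℍ ⊆ 𝔾`, a morphism
`S|_ℍ → T|_ℍ` of `B^cov(𝒢_ℍ)` extends to `S → T` (same vertex components, same edge components over
`ℍ`, forced components over the omitted cusps). [cite: Mochizuki2012, §2 p.44] -/
noncomputable def homOfRestrict (hH : H.IsCuspOmission) {S T : CovObj 𝒢}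
    (g : (𝒢.covRestrict H).obj S ⟶ (𝒢.covRestrict H).obj T) : S ⟶ T where
  fV v := g.fV (hH.vtx v)
  fE e :=
    if he : e ∈ H.edges then g.fE ⟨e, he⟩
    else cuspHom S T (hH.cuspBranch e he) (g.fV (hH.vtx _))
  comm b v h := by
    by_cases hb : 𝒢.graph.edgeOf b ∈ H.edges
    · rw [dif_pos hb]
      exact g.comm ⟨b, hb⟩ (hH.vtx v) ((H.abuts_mk_eq_some_iff hb _).mpr h)
    · rw [dif_neg hb]
      exact cuspHom_comm S T (fun v => g.fV (hH.vtx v)) h _ (hH.eq_cusp (he := hb) rfl h).1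

open Classical in
/-- The edge fibres of the extension of an object `A'` of `B^cov(𝒢_ℍ)` along a cusp omission `ℍ`:
`S_e` over an edge of `ℍ`, and `b^* S_v` over an omitted cusp `e ⊸ v` with verticial branch `b`.
[cite: Mochizuki2012, §2 p.44] -/
noncomputable def extendSE (hH : H.IsCuspOmission) (A' : CovObj (𝒢.restrict H))
    (e : 𝒢.graph.Edge) : BTemp (𝒢.Ge e) :=
  if he : e ∈ H.edges then A'.SE ⟨e, he⟩
  else cuspSE (fun v => A'.SV (hH.vtx v)) (hH.cuspBranch e he)

open Classical in
/-- `extendSE` over an edge of `ℍ`. [cite: Mochizuki2012, §2 p.44] -/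
theorem extendSE_of_mem (hH : H.IsCuspOmission) (A' : CovObj (𝒢.restrict H))
    {e : 𝒢.graph.Edge} (he : e ∈ H.edges) : extendSE hH A' e = A'.SE ⟨e, he⟩ := by
  show dite _ _ _ = _
  exact dif_pos he

open Classical in
/-- `extendSE` over an omitted cusp. [cite: Mochizuki2012, §2 p.44] -/
theorem extendSE_of_not_mem (hH : H.IsCuspOmission) (A' : CovObj (𝒢.restrict H))
    {e : 𝒢.graph.Edge} (he : e ∉ H.edges) :
    extendSE hH A' e = cuspSE (fun v => A'.SV (hH.vtx v)) (hH.cuspBranch e he) := by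
  show dite _ _ _ = _
  exact dif_neg he

open Classical in
/-- **Extension of an object along a cusp omission**: for a cusp omission `ℍ ⊆ 𝔾`, an object
`A' = {S_v, S_e, glue}` of `B^cov(𝒢_ℍ)` extends to `B^cov(𝒢)` — same vertex fibres (every vertex
lies in `ℍ`), same edge fibres and gluings over `ℍ`, and over an omitted cusp `e ⊸ v` with verticial
branch `b` the fibre `b^* S_v` glued by the identity. [cite: Mochizuki2012, §2 p.44] -/
noncomputable def extendAlongCusps (hH : H.IsCuspOmission) (A' : CovObj (𝒢.restrict H)) :
    CovObj 𝒢 where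
  SV v := A'.SV (hH.vtx v)
  SE e := extendSE hH A' e
  glue b v h :=
    if hb : 𝒢.graph.edgeOf b ∈ H.edges then
      eqToIso (extendSE_of_mem hH A' hb) ≪≫ A'.glue ⟨b, hb⟩ (hH.vtx v) ((H.abuts_mk_eq_some_iff hb _).mpr h)
    else
      eqToIso ((extendSE_of_not_mem hH A' hb).trans (res_obj_eq_cuspSE (fun v => A'.SV (hH.vtx v))
        h _ (hH.eq_cusp (he := hb) rfl h).1).symm)

/-- The restriction of the extended object has the given vertex fibres (definitional).
[cite: Mochizuki2012, §2 p.44] -/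
@[simp] theorem covRestrict_extendAlongCusps_SV (hH : H.IsCuspOmission)
    (A' : CovObj (𝒢.restrict H)) (w : (𝒢.restrict H).graph.Vertex) :
    ((𝒢.covRestrict H).obj (extendAlongCusps hH A')).SV w = A'.SV w := rfl

/-- The restriction of the extended object has the given edge fibres.
[cite: Mochizuki2012, §2 p.44] -/
theorem covRestrict_extendAlongCusps_SE (hH : H.IsCuspOmission) (A' : CovObj (𝒢.restrict H))
    (e : (𝒢.restrict H).graph.Edge) :
    ((𝒢.covRestrict H).obj (extendAlongCusps hH A')).SE e = A'.SE e :=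
  extendSE_of_mem hH A' e.2

open Classical in
/-- Over a branch of an edge of `ℍ`, the restriction of the extended object has the given gluing
(up to the transport of `covRestrict_extendAlongCusps_SE`). [cite: Mochizuki2012, §2 p.44] -/
theorem covRestrict_extendAlongCusps_glue (hH : H.IsCuspOmission) (A' : CovObj (𝒢.restrict H))
    (b : (𝒢.restrict H).graph.Branch) (w : (𝒢.restrict H).graph.Vertex)
    (h' : (𝒢.restrict H).graph.abuts b = some w) :
    ((𝒢.covRestrict H).obj (extendAlongCusps hH A')).glue b w h' =
      eqToIso (covRestrict_extendAlongCusps_SE hH A' ((𝒢.restrict H).graph.edgeOf b)) ≪≫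
        A'.glue b w h' := by
  show dite _ _ _ = _
  exact dif_pos b.2

/-- **The restriction of the extension is the given object**: `(extendAlongCusps A')|_ℍ ≅ A'`
(identity on vertex fibres, the transport on edge fibres). [cite: Mochizuki2012, §2 p.44] -/
noncomputable def extendAlongCuspsIso (hH : H.IsCuspOmission) (A' : CovObj (𝒢.restrict H)) :
    (𝒢.covRestrict H).obj (extendAlongCusps hH A') ≅ A' where
  hom :=
    { fV := fun w => 𝟙 (A'.SV w)
      fE := fun e => eqToHom (covRestrict_extendAlongCusps_SE hH A' e)
      comm := fun b w h' => by
        rw [covRestrict_extendAlongCusps_glue hH A' b w h']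
        simp only [covRestrict_extendAlongCusps_SV, Iso.trans_hom, eqToIso.hom,
          CategoryTheory.Functor.map_id, Category.comp_id] }
  inv :=
    { fV := fun w => 𝟙 (A'.SV w)
      fE := fun e => eqToHom (covRestrict_extendAlongCusps_SE hH A' e).symm
      comm := fun b w h' => by
        rw [covRestrict_extendAlongCusps_glue hH A' b w h']
        simp only [covRestrict_extendAlongCusps_SV, Iso.trans_hom, eqToIso.hom,
          CategoryTheory.Functor.map_id, Category.comp_id, eqToHom_trans_assoc, eqToHom_refl,
          Category.id_comp] }
  hom_inv_id := by
    apply CovHom.ext <;> funext x <;> simp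
  inv_hom_id := by
    apply CovHom.ext <;> funext x <;> simp

/-! ### Points over the omitted cusps -/

/-- Transport of a point of the edge fibre `S_{e₁}` to `S_{e₂}` along `e₁ = e₂` (the identity when
`e₁ ≡ e₂`). [cite: MochizukiSemiAnbd2006, Def 3.5(ii) p.37] -/
def castPoint (S : CovObj 𝒢) {e₁ e₂ : 𝒢.graph.Edge} (h : e₁ = e₂) (x : (S.SE e₁).obj.V) :
    (S.SE e₂).obj.V :=
  h ▸ x

/-- Transport along a reflexive equality is the identity. [cite: MochizukiSemiAnbd2006, Def 3.5(ii) p.37] -/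
@[simp] theorem castPoint_rfl (S : CovObj 𝒢) {e : 𝒢.graph.Edge} (x : (S.SE e).obj.V) :
    castPoint S rfl x = x := rfl

open Classical in
/-- **Retraction of the points of `S` onto the points of `S|_ℍ`** for a cusp omission `ℍ`: points
over vertices and over edges of `ℍ` are kept; a point `x` over an omitted cusp `e ⊸ v` (verticial
branch `b`) goes to its glued image `glue_b(x) ∈ S_v` — the point it is adjacent to in the covering
`𝒢' → 𝒢` ([SemiAnbd] Def. 3.5 (ii): connected components). [cite: Mochizuki2012, §2 p.44] -/
noncomputable def retractPoint (hH : H.IsCuspOmission) (S : CovObj 𝒢) :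
    S.Point → ((𝒢.covRestrict H).obj S).Point
  | Sum.inl ⟨v, x⟩ => Sum.inl ⟨hH.vtx v, x⟩
  | Sum.inr ⟨e, x⟩ =>
    if he : e ∈ H.edges then Sum.inr ⟨⟨e, he⟩, x⟩
    else Sum.inl ⟨hH.vtx (hH.cuspBranch e he).vertex,
      (S.glue (hH.cuspBranch e he).branch (hH.cuspBranch e he).vertex
          (hH.cuspBranch e he).abuts_branch).hom.hom.hom
        (castPoint S (hH.cuspBranch e he).edgeOf_branch.symm x)⟩

/-- The retraction on a vertex point. [cite: Mochizuki2012, §2 p.44] -/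
@[simp] theorem retractPoint_inl (hH : H.IsCuspOmission) (S : CovObj 𝒢) (v : 𝒢.graph.Vertex)
    (x : (S.SV v).obj.V) : retractPoint hH S (Sum.inl ⟨v, x⟩) = Sum.inl ⟨hH.vtx v, x⟩ := rfl

open Classical in
/-- The retraction on a point over an edge of `ℍ`. [cite: Mochizuki2012, §2 p.44] -/
theorem retractPoint_inr_of_mem (hH : H.IsCuspOmission) (S : CovObj 𝒢) {e : 𝒢.graph.Edge}
    (he : e ∈ H.edges) (x : (S.SE e).obj.V) :
    retractPoint hH S (Sum.inr ⟨e, x⟩) = Sum.inr ⟨⟨e, he⟩, x⟩ := by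
  show dite _ _ _ = _
  exact dif_pos he

open Classical in
/-- The retraction on a point over an omitted cusp. [cite: Mochizuki2012, §2 p.44] -/
theorem retractPoint_inr_of_not_mem (hH : H.IsCuspOmission) (S : CovObj 𝒢) {e : 𝒢.graph.Edge}
    (he : e ∉ H.edges) (x : (S.SE e).obj.V) :
    retractPoint hH S (Sum.inr ⟨e, x⟩) = Sum.inl ⟨hH.vtx (hH.cuspBranch e he).vertex,
      (S.glue (hH.cuspBranch e he).branch (hH.cuspBranch e he).vertex
          (hH.cuspBranch e he).abuts_branch).hom.hom.hom
        (castPoint S (hH.cuspBranch e he).edgeOf_branch.symm x)⟩ := by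
  show dite _ _ _ = _
  exact dif_neg he

/-- The retraction is a left inverse of the inclusion of the points of `S|_ℍ`.
[cite: Mochizuki2012, §2 p.44] -/
theorem retractPoint_pointOfRestrict (hH : H.IsCuspOmission) (S : CovObj 𝒢)
    (p : ((𝒢.covRestrict H).obj S).Point) : retractPoint hH S (S.pointOfRestrict p) = p := by
  rcases p with ⟨⟨v, hv⟩, x⟩ | ⟨⟨e, he⟩, x⟩
  · rfl
  · exact retractPoint_inr_of_mem hH S he x

end CovObj

end ProfiniteSemiGraph

end Literature.AnabelianGeometry.SemiGraphs
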